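import Summits.AtomisticToContinuum.FouriersLaw.Theorems.BondHeatUncertaintyLinearResponseFTURLineDefs

/-!
# Line `lebesgue-flip-duality` of crux ★ `BondHeatUncertainty.LinearResponseFTUR`: transfer and composition

Support file for the crux item stmt-AtomisticToContinuum-9122; sequel of `…LineDefs.lean`. PROVED:
`transfer : TransferStatement` (`C⁺ ⇒ ★`: the vendored Hasegawa–Van Vu FTUR on the observable space at
each small bias `δ`, then `δ → 0` through `shape_of_hvv_family`) and
`lineComposition : LineComposition` (the seven stub statements imply the crux).
-/

noncomputable section

namespace Summit.AtomisticToContinuum.FouriersLaw.Theorems.LinearResponseFTUR.Line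


open MeasureTheory ProbabilityTheory Filter Topology
open scoped NNReal ENNReal
open Literature.MathematicalPhysics.KineticTheory
open Literature.MathematicalPhysics.KineticTheory.HeatConduction
open Literature.Probability.Process
open Summit.AtomisticToContinuum.FouriersLaw.Theses.BondHeatUncertainty
open Summit.AtomisticToContinuum.FouriersLaw.Theorems.BondHeatUncertainty

/-! ## The `δ → 0` certificate (= Disproof.lean §7, re-proved so that the skeleton is self-contained) -/

/-- Carnot factor algebra: `1/(T - δ/2) - 1/(T + δ/2) = δ / (T² - δ²/4)`. -/
theorem inv_sub_inv_temperatures {T δ : ℝ} (h₁ : T - δ / 2 ≠ 0) (h₂ : T + δ / 2 ≠ 0) :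
    1 / (T - δ / 2) - 1 / (T + δ / 2) = δ / (T ^ 2 - δ ^ 2 / 4) := by
  have h3 : T ^ 2 - δ ^ 2 / 4 = (T - δ / 2) * (T + δ / 2) := by ring
  rw [h3, div_sub_div _ _ h₁ h₂]
  congr 1
  ring

/-- `exp x - 1 ≤ x · exp x`. -/
theorem exp_sub_one_le_mul_exp (x : ℝ) : Real.exp x - 1 ≤ x * Real.exp x := by
  have h := Real.add_one_le_exp (-x)
  have hx := Real.exp_pos x
  have : Real.exp (-x) * Real.exp x = 1 := by rw [← Real.exp_add]; simp
  nlinarith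

/-- **Bookkeeping certificate (Disproof §7 `fturShape_pointwise_of_hvv_family`).** At one bond and
one `t > 0`, with `m δ = ⟨Q_t⟩_δ`, `v δ = Var_δ(Q_t)`, `s δ = ⟨Σ_t⟩_δ` along `T ± δ/2`: HVV at each
`δ`, `v ≥ 0`, `m δ/δ → G t`, `v δ → V` and `s δ ≤ (m δ/t)(1/(T-δ/2) - 1/(T+δ/2)) t + K δ²` give
`2 G² t² ≤ V (G t/T² + K)`. -/
theorem shape_of_hvv_family {m v s : ℝ → ℝ} {G T K V t : ℝ} (ht : 0 < t) (hT : 0 < T)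
    (hHVV : ∀ᶠ δ in 𝓝[≠] (0 : ℝ), m δ ^ 2 ≤ 1 / 2 * v δ * (Real.exp (s δ) - 1))
    (hv0 : ∀ᶠ δ in 𝓝[≠] (0 : ℝ), 0 ≤ v δ)
    (hm : Tendsto (fun δ => m δ / δ) (𝓝[≠] 0) (𝓝 (G * t)))
    (hv : Tendsto v (𝓝[≠] 0) (𝓝 V))
    (hs : ∀ᶠ δ in 𝓝[≠] (0 : ℝ),
      s δ ≤ m δ / t * (1 / (T - δ / 2) - 1 / (T + δ / 2)) * t + K * δ ^ 2) :
    2 * G ^ 2 * t ^ 2 ≤ V * (G * t / T ^ 2 + K) := by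
  have _ := ht
  set w : ℝ → ℝ := fun δ => m δ / δ / (T ^ 2 - δ ^ 2 / 4) + K with hw_def
  have hI : ∀ᶠ δ in 𝓝[≠] (0 : ℝ), δ ∈ Set.Ioo (-T) T ∧ δ ≠ 0 := by
    have h1 : ∀ᶠ δ in 𝓝 (0 : ℝ), δ ∈ Set.Ioo (-T) T := Ioo_mem_nhds (by linarith) hT
    have h1' : ∀ᶠ δ in 𝓝[≠] (0 : ℝ), δ ∈ Set.Ioo (-T) T := mem_nhdsWithin_of_mem_nhds h1
    have h2' : ∀ᶠ δ in 𝓝[≠] (0 : ℝ), δ ≠ 0 := self_mem_nhdsWithin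
    exact h1'.and h2'
  have hden : Tendsto (fun δ : ℝ => T ^ 2 - δ ^ 2 / 4) (𝓝[≠] 0) (𝓝 (T ^ 2)) := by
    have : Tendsto (fun δ : ℝ => T ^ 2 - δ ^ 2 / 4) (𝓝 0) (𝓝 (T ^ 2 - 0 ^ 2 / 4)) :=
      ((continuous_const.sub ((continuous_pow 2).div_const 4)).tendsto 0)
    simpa using this.mono_left nhdsWithin_le_nhds
  have hw : Tendsto w (𝓝[≠] 0) (𝓝 (G * t / T ^ 2 + K)) :=
    (hm.div hden (by positivity)).add tendsto_const_nhds
  have hsq : Tendsto (fun δ : ℝ => δ ^ 2) (𝓝[≠] 0) (𝓝 0) := by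
    have : Tendsto (fun δ : ℝ => δ ^ 2) (𝓝 0) (𝓝 (0 ^ 2)) := (continuous_pow 2).tendsto 0
    simpa using this.mono_left nhdsWithin_le_nhds
  have hx : Tendsto (fun δ : ℝ => δ ^ 2 * w δ) (𝓝[≠] 0) (𝓝 0) := by
    simpa using hsq.mul hw
  have hexp : Tendsto (fun δ : ℝ => Real.exp (δ ^ 2 * w δ)) (𝓝[≠] 0) (𝓝 1) := by
    have := (Real.continuous_exp.tendsto 0).comp hx
    simpa [Function.comp_def] using this
  have hs' : ∀ᶠ δ in 𝓝[≠] (0 : ℝ), s δ ≤ δ ^ 2 * w δ := by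
    filter_upwards [hs, hI] with δ hδ hδI
    obtain ⟨⟨hlo, hhi⟩, hne⟩ := hδI
    have h₁ : T - δ / 2 ≠ 0 := by intro h; linarith
    have h₂ : T + δ / 2 ≠ 0 := by intro h; linarith
    have h₃ : T ^ 2 - δ ^ 2 / 4 ≠ 0 := by
      have : T ^ 2 - δ ^ 2 / 4 = (T - δ / 2) * (T + δ / 2) := by ring
      rw [this]; exact mul_ne_zero h₁ h₂
    have e : m δ / t * (1 / (T - δ / 2) - 1 / (T + δ / 2)) * t + K * δ ^ 2 = δ ^ 2 * w δ := by
      rw [inv_sub_inv_temperatures h₁ h₂, hw_def]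
      field_simp
    linarith [hδ, e.le, e.ge]
  have hev : ∀ᶠ δ in 𝓝[≠] (0 : ℝ),
      (m δ / δ) ^ 2 ≤ 1 / 2 * v δ * (w δ * Real.exp (δ ^ 2 * w δ)) := by
    filter_upwards [hHVV, hv0, hs', hI] with δ h1 h2 h3 hδI
    obtain ⟨-, hne⟩ := hδI
    have hδ2 : 0 < δ ^ 2 := by positivity
    have h4 : Real.exp (s δ) - 1 ≤ Real.exp (δ ^ 2 * w δ) - 1 := by
      linarith [Real.exp_le_exp.mpr h3]
    have h5 : Real.exp (δ ^ 2 * w δ) - 1 ≤ δ ^ 2 * w δ * Real.exp (δ ^ 2 * w δ) :=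
      exp_sub_one_le_mul_exp _
    have h6 : m δ ^ 2 ≤ 1 / 2 * v δ * (δ ^ 2 * w δ * Real.exp (δ ^ 2 * w δ)) := by
      have := mul_le_mul_of_nonneg_left (h4.trans h5) (by positivity : (0 : ℝ) ≤ 1 / 2 * v δ)
      exact h1.trans this
    rw [div_pow, div_le_iff₀ hδ2]
    calc m δ ^ 2 ≤ 1 / 2 * v δ * (δ ^ 2 * w δ * Real.exp (δ ^ 2 * w δ)) := h6
      _ = 1 / 2 * v δ * (w δ * Real.exp (δ ^ 2 * w δ)) * δ ^ 2 := by ring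
  have hL : Tendsto (fun δ => (m δ / δ) ^ 2) (𝓝[≠] 0) (𝓝 ((G * t) ^ 2)) := hm.pow 2
  have hR : Tendsto (fun δ => 1 / 2 * v δ * (w δ * Real.exp (δ ^ 2 * w δ))) (𝓝[≠] 0)
      (𝓝 (1 / 2 * V * ((G * t / T ^ 2 + K) * 1))) :=
    (tendsto_const_nhds.mul hv).mul (hw.mul hexp)
  have key : (G * t) ^ 2 ≤ 1 / 2 * V * ((G * t / T ^ 2 + K) * 1) :=
    le_of_tendsto_of_tendsto hL hR hev
  nlinarith [key]

/-- Near `δ = 0` both bath temperatures `T ± δ/2` are positive. -/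
theorem eventually_temperatures_pos {T : ℝ} (hT : 0 < T) :
    ∀ᶠ δ in 𝓝[≠] (0 : ℝ), 0 < T + δ / 2 ∧ 0 < T - δ / 2 := by
  have h1 : ∀ᶠ δ in 𝓝 (0 : ℝ), δ < 2 * T := eventually_lt_nhds (by linarith)
  have h2 : ∀ᶠ δ in 𝓝 (0 : ℝ), -(2 * T) < δ := eventually_gt_nhds (by linarith)
  refine mem_nhdsWithin_of_mem_nhds ?_
  filter_upwards [h1, h2] with δ ha hb
  exact ⟨by linarith, by linarith⟩

/-- **TRANSFER `C⁺ ⇒ ★` (PROVED).** The heat-flux detailed balance, the entropy balance it yields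
(K4), the steady heat rates, the equilibrium variance identity (K6a), the δ-continuity of the
bond-heat variance (K6b) and the finite-bias Clausius inequality (from (GDB)) imply the crux: at each
small `δ ≠ 0` instantiate the vendored (PROVED) Hasegawa–Van Vu FTUR on `Obs N` with
`P := fluxLaw … μ_δ`, `ι := flipObs`, `φ := Q^b` (exactly odd), and let `δ → 0` through
`shape_of_hvv_family`; (a) from Clausius (injected-power form) + the fourth conjunct of the rates by
`ge_of_tendsto`. -/
theorem transfer : TransferStatement := by
  intro hGDB h4 hR hV0 hV hC
  have hEB : StationaryEntropyBalance := h4 hGDB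
  have hCl : FiniteBiasClausius := hC hGDB
  intro ω₂ lam β γ hω hl hβ hγ huniq μ hμ T hT D hD P C V N hN
  have h2T := eventually_temperatures_pos hT
  have hN1 : (0 : ℝ) < (N : ℝ) - 1 := by
    have : (2 : ℝ) ≤ (N : ℝ) := by exact_mod_cast hN
    linarith
  let i0 : Fin N := ⟨0, by omega⟩
  let iN : Fin N := ⟨N - 1, by omega⟩
  have hi0 : i0.val = 0 := rfl
  have hiN : iN.val = N - 1 := rfl
  refine ⟨?_, ?_⟩
  · -- (a): the finite-bias second law `δ · J_δ ≥ 0` in injected-power form, then `δ → 0`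
    refine ge_of_tendsto (hD N) ?_
    filter_upwards [h2T, self_mem_nhdsWithin] with δ hδ hne
    have hne' : δ ≠ 0 := hne
    -- Clausius: `0 ≤ (T_L - T_R) ⟨p_0 ∂_{q_0}H⟩`
    have h0 := hCl ω₂ lam β γ hω hl hβ hγ huniq N i0 hN hi0 (T + δ / 2) (T - δ / 2) hδ.1 hδ.2
      (μ N (T + δ / 2) (T - δ / 2)) (hμ N _ _ hδ.1 hδ.2)
    -- rates, fourth conjunct (bond `0`, `t = 0`): `⟨p_0 ∂_{q_0}H⟩ = J = totalCurrent/(N-1)`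
    obtain ⟨-, -, -, hW⟩ := hR ω₂ lam β γ hω hl hβ hγ huniq N i0 iN i0 hN hi0 hiN
      (by show 0 + 1 < N; omega) (T + δ / 2) (T - δ / 2) hδ.1 hδ.2
      (μ N (T + δ / 2) (T - δ / 2)) (hμ N _ _ hδ.1 hδ.2) 0 le_rfl
    have e : T + δ / 2 - (T - δ / 2) = δ := by ring
    rw [e, hW] at h0
    -- `0 ≤ δ · (totalCurrent / (N-1))` ⇒ `0 ≤ totalCurrent / δ`
    show 0 ≤ (pinnedChain ω₂ lam β γ).totalCurrent (μ N (T + δ / 2) (T - δ / 2)) / δ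
    set J := (pinnedChain ω₂ lam β γ).totalCurrent (μ N (T + δ / 2) (T - δ / 2)) with hJ
    have h1 : 0 ≤ δ * J := by
      have := mul_nonneg h0 hN1.le
      have e2 : δ * (J / ((N : ℝ) - 1)) * ((N : ℝ) - 1) = δ * J := by
        field_simp
      linarith [e2.symm.le, e2.le]
    have e3 : J / δ = δ * J / δ ^ 2 := (div_eq_div_iff hne' (pow_ne_zero 2 hne')).2 (by ring)
    rw [e3]
    exact div_nonneg h1 (sq_nonneg δ)
  · -- (b): HVV at each small `δ`, then the bookkeeping certificate
    intro b hb t ht K hK hKL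
    let ib : Fin N := ⟨b, by omega⟩
    have hib : ib.val + 1 < N := hb
    let μδ : ℝ → Measure (PhaseSpace N) := fun δ => μ N (T + δ / 2) (T - δ / 2)
    let Pf : ℝ → Measure (Obs N) := fun δ =>
      fluxLaw (pinnedChain ω₂ lam β γ) N i0 iN ib (T + δ / 2) (T - δ / 2) t (μδ δ)
    let φ : Obs N → ℝ := fun p => p.2.2.2.2
    let J : ℝ → ℝ := fun δ => (pinnedChain ω₂ lam β γ).totalCurrent (μδ δ) / ((N : ℝ) - 1)
    let m : ℝ → ℝ := fun δ => t * J δ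
    let v : ℝ → ℝ := fun δ => variance φ (Pf δ)
    let s : ℝ → ℝ := fun δ => ∫ p, llr (Pf δ) ((Pf δ).map (flipObs N)) p ∂(Pf δ)
    have hKLfin : ∀ᶠ δ in 𝓝[≠] (0 : ℝ), InformationTheory.klDiv (μδ δ)
        (Measure.map (fun x : PhaseSpace N => (x.1, -x.2)) (μδ δ)) ≠ ⊤ := by
      filter_upwards [hKL] with δ hδ
      exact ne_top_of_le_ne_top ENNReal.ofReal_ne_top hδ
    obtain ⟨hMem, hvlim⟩ := hV ω₂ lam β γ hω hl hβ hγ huniq μ hμ T hT N i0 iN ib hN hi0 hiN hib t ht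
    obtain ⟨-, hV0eq⟩ := hV0 ω₂ lam β γ hω hl hβ hγ huniq μ hμ T hT N i0 iN ib hN hi0 hiN hib t ht
    have hvlim' : Tendsto v (𝓝[≠] 0) (𝓝 (bondHeatVariance ω₂ lam β γ T N b t)) := by
      have e : bondHeatVariance ω₂ lam β γ T N b t = variance (fun p : Obs N => p.2.2.2.2)
          (fluxLaw (pinnedChain ω₂ lam β γ) N i0 iN ib T T t (μ N T T)) := hV0eq.symm
      rw [e]
      exact hvlim
    have key : 2 * (D N / ((N : ℝ) - 1)) ^ 2 * t ^ 2 ≤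
        bondHeatVariance ω₂ lam β γ T N b t * (D N / ((N : ℝ) - 1) * t / T ^ 2 + K) := by
      refine shape_of_hvv_family (m := m) (v := v) (s := s) ht hT ?_ ?_ ?_ hvlim' ?_
      · -- the Hasegawa–Van Vu inequality at each small `δ`
        filter_upwards [h2T, hKLfin, hMem] with δ hδ hfin hmem
        obtain ⟨hprob, hac1, hac2, hllr, -, -, -⟩ :=
          hEB ω₂ lam β γ hω hl hβ hγ huniq N i0 iN ib hN hi0 hiN (T + δ / 2) (T - δ / 2) hδ.1 hδ.2
            (μδ δ) (hμ N _ _ hδ.1 hδ.2) hfin t ht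
        obtain ⟨-, -, hQb, -⟩ :=
          hR ω₂ lam β γ hω hl hβ hγ huniq N i0 iN ib hN hi0 hiN hib (T + δ / 2) (T - δ / 2) hδ.1 hδ.2
            (μδ δ) (hμ N _ _ hδ.1 hδ.2) t ht.le
        haveI : IsProbabilityMeasure (Pf δ) := hprob
        have hftur := Literature.Probability.Entropy.HasegawaVanVu2019_FTUR_holds (Obs N) (Pf δ)
          (flipObs N) (measurable_flipObs N) (flipObs_involutive N) hac1 hac2 hllr φ hmem
          (fun p => rfl)
        have hmean : ∫ p, φ p ∂(Pf δ) = m δ := hQb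
        rw [hmean] at hftur
        exact hftur
      · exact Eventually.of_forall fun δ => variance_nonneg _ _
      · -- `m δ / δ → G t`
        have hlim := ((hD N).const_mul t).div_const ((N : ℝ) - 1)
        have e1 : (fun δ => m δ / δ) = fun δ =>
            t * ((pinnedChain ω₂ lam β γ).totalCurrent (μ N (T + δ / 2) (T - δ / 2)) / δ) /
              ((N : ℝ) - 1) := by
          funext δ
          simp only [m, J, μδ]
          ring
        have e2 : D N / ((N : ℝ) - 1) * t = t * D N / ((N : ℝ) - 1) := by ring
        rw [e1, e2]
        exact hlim
      · -- the entropy balance: `⟨Σ_t⟩_δ = KL(μ_δ‖Θμ_δ) + t J_δ (1/T_R - 1/T_L) ≤ K δ² + …`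
        filter_upwards [h2T, hKLfin, hKL] with δ hδ hfin hKδ
        obtain ⟨-, -, -, -, -, -, hllr_eq⟩ :=
          hEB ω₂ lam β γ hω hl hβ hγ huniq N i0 iN ib hN hi0 hiN (T + δ / 2) (T - δ / 2) hδ.1 hδ.2
            (μδ δ) (hμ N _ _ hδ.1 hδ.2) hfin t ht
        obtain ⟨hQL, hQR, -, -⟩ :=
          hR ω₂ lam β γ hω hl hβ hγ huniq N i0 iN ib hN hi0 hiN hib (T + δ / 2) (T - δ / 2) hδ.1 hδ.2
            (μδ δ) (hμ N _ _ hδ.1 hδ.2) t ht.le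
        have hKL' : (InformationTheory.klDiv (μδ δ)
            (Measure.map (fun x : PhaseSpace N => (x.1, -x.2)) (μδ δ))).toReal ≤ K * δ ^ 2 :=
          ENNReal.toReal_le_of_le_ofReal (by positivity) hKδ
        have hs_val : s δ = (InformationTheory.klDiv (μδ δ)
            (Measure.map (fun x : PhaseSpace N => (x.1, -x.2)) (μδ δ))).toReal -
              t * J δ / (T + δ / 2) - -(t * J δ) / (T - δ / 2) := by
          show ∫ p, llr (Pf δ) ((Pf δ).map (flipObs N)) p ∂(Pf δ) = _
          rw [hllr_eq, hQL, hQR]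
        have e3 : m δ / t * (1 / (T - δ / 2) - 1 / (T + δ / 2)) * t =
            t * J δ * (1 / (T - δ / 2) - 1 / (T + δ / 2)) := by
          show t * J δ / t * (1 / (T - δ / 2) - 1 / (T + δ / 2)) * t = _
          field_simp
        have e4 : (InformationTheory.klDiv (μδ δ)
            (Measure.map (fun x : PhaseSpace N => (x.1, -x.2)) (μδ δ))).toReal -
              t * J δ / (T + δ / 2) - -(t * J δ) / (T - δ / 2) =
            (InformationTheory.klDiv (μδ δ)
              (Measure.map (fun x : PhaseSpace N => (x.1, -x.2)) (μδ δ))).toReal +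
              t * J δ * (1 / (T - δ / 2) - 1 / (T + δ / 2)) := by
          ring
        rw [hs_val, e3, e4]
        linarith [hKL']
    exact key

/-- **COMPOSITION (PROVED, no `sorry`, axioms `propext`/`Classical.choice`/`Quot.sound`).** The seven
stub statements imply the crux: `transfer ∘ heatFluxDetailedBalance_of`. -/
theorem lineComposition : LineComposition := fun h1 h3 h4 hR hV0 hV hC =>
  transfer (heatFluxDetailedBalance_of h1 h3) h4 hR hV0 hV hC

end Summit.AtomisticToContinuum.FouriersLaw.Theorems.LinearResponseFTUR.Line

end
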